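import Literature.MathematicalPhysics.QuantumLattice.GrassmannIntegralPartial
import Mathlib.Analysis.Normed.Field.Basic
import HarnessLib

/-!
# Monomials of `Λ(ι ⊕ₗ ι)` as two-block words; coefficients through the Berezin pairing

Trunk **QLatticeAQFT**; companion of `GrassmannIntegralPartial.lean` /
`GrassmannIntegralCoefficients.lean`.  Two pieces of bookkeeping for expanding an element of a
complex-fermion Grassmann algebra `Λ(ι ⊕ₗ ι)` (`ψ̄ = inl` before `ψ = inr`) in the monomial basis
`θ_s = grassmannBasis`, `s : Finset (ι ⊕ₗ ι)`, and controlling the coefficients: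

* `exists_grassmannBasis_sumLex_eq` — **every monomial `θ_s` is a two-block word**
  `ψ̄_{i₁} ⋯ ψ̄_{i_k} ψ_{j₁} ⋯ ψ_{j_l}` with injective `i`, `j` enumerating the `ψ̄`- and
  `ψ`-letters of `s` (`w ∈ s ↔ w = ψ̄_{i_a} ∨ w = ψ_{j_b}`); produced existentially, to be
  consumed with `choose`; `sum_eq_of_mem_iff_blocks` — sums over `s` split accordingly;
* `GrassmannAlgebra.berezin_mul_grassmannBasis_compl` — **coefficient extraction by the Berezin
  pairing**: `∫ x θ_{sᶜ} = ε_s x_s` with `ε_s = berezinSign sᶜ univ = ±1` and `x_s` the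
  coordinate of `x` on `θ_s` (`berezin_grassmannBasis_mul_grassmannBasis_compl`:
  `∫ θ_t θ_{sᶜ} = [t = s] ε_s`); `norm_repr_grassmannBasis` (`‖x_s‖ = ‖∫ x θ_{sᶜ}‖` over a
  normed field);
* `GrassmannAlgebra.sub_mul_repr_eq_zero_of_eigen` — if a linear map acts diagonally on the
  monomials, `φ θ_t = μ_t θ_t`, and `φ x = c x`, then `(μ_s - c) x_s = 0` (comparison of
  coefficients; the selection rule behind symmetry charges of monomials);
* `GrassmannAlgebra.berezin_map_mul_map_mul` — bilinear expansion
  `∫ Φ₁(x) Φ₂(y) z = Σ_{s,t} x_s y_t ∫ Φ₁(θ_s) Φ₂(θ_t) z` for algebra maps `Φ₁`, `Φ₂` into a common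
  Grassmann algebra.

## Sources

I. Montvay, G. Münster, *Quantum Fields on a Lattice* (CUP, 1994), §4.1.3, (4.20)–(4.21): every
element is a unique combination of the ordered monomials `η⁺… η…`, and the integral over all
variables extracts the top coefficient.  Bib key `MontvayMunster1994`.
F. A. Berezin, *The Method of Second Quantization* (1966), Ch. I §3, (3.3)–(3.5).

## Design

No definition is introduced.  The blocks of a monomial are given existentially rather than
through `Finset.toLeft`/`orderEmbOfFin`, which keeps the consumer's bookkeeping to the two
exported properties (membership and the product formula).  Not here: Gaussian integration
(`GrassmannGaussianWordWick.lean`).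
-/

noncomputable section

namespace Literature.MathematicalPhysics.QuantumLattice

section QLatticeAQFT

open ExteriorAlgebra GrassmannAlgebra

/-! ### Monomials of `Λ(ι ⊕ₗ ι)` are two-block words -/

section SumLex

open GrassmannAlgebra

variable (R : Type*) [CommRing R] {ι : Type*} [LinearOrder ι] [Fintype ι]

/-- **Every monomial `θ_s` of `Λ(ι ⊕ₗ ι)` is a two-block word**
`ψ̄_{i₁} ⋯ ψ̄_{i_k} ψ_{j₁} ⋯ ψ_{j_l}`
(all `ψ̄ = inl` precede all `ψ = inr` in the lexicographic sum), with injective `i`, `j`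
enumerating the `ψ̄`- and `ψ`-letters of `s` (Montvay–Münster (4.20): the ordered monomials
`η⁺_{i₁}⋯η_{j₁}⋯`). [cite: MontvayMunster1994, §4.1.3 (4.20)] -/
theorem exists_grassmannBasis_sumLex_eq (s : Finset (ι ⊕ₗ ι)) :
    ∃ (k l : ℕ) (i : Fin k → ι) (j : Fin l → ι), Function.Injective i ∧ Function.Injective j ∧
      (∀ w, w ∈ s ↔ (∃ a, w = toLex (Sum.inl (i a))) ∨ ∃ b, w = toLex (Sum.inr (j b))) ∧
      grassmannBasis R (ι ⊕ₗ ι) s =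
        (List.ofFn fun a => psiBar R (i a)).prod * (List.ofFn fun b => psi R (j b)).prod := by
  induction s using Finset.induction_on_min with
  | empty =>
    exact ⟨0, 0, Fin.elim0, Fin.elim0, Function.injective_of_subsingleton _,
      Function.injective_of_subsingleton _, fun w => by simp, by simp⟩
  | insert m u hmin ih =>
    obtain ⟨k, l, i, j, hi, hj, hmem, hu⟩ := ih
    have hm : m ∉ u := fun h => lt_irrefl m (hmin m h)
    obtain ⟨m, rfl⟩ := toLex.surjective m
    rcases m with x | y
    · -- the new smallest letter is `ψ̄_x`
      refine ⟨k + 1, l, Fin.cons x i, j, Fin.cons_injective_iff.2 ⟨?_, hi⟩, hj, fun w => ?_, ?_⟩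
      · rintro ⟨a, ha⟩
        exact hm ((hmem _).2 (Or.inl ⟨a, by rw [ha]⟩))
      · rw [Finset.mem_insert, hmem]
        constructor
        · rintro (rfl | ⟨a, rfl⟩ | ⟨b, rfl⟩)
          · exact Or.inl ⟨0, by simp⟩
          · exact Or.inl ⟨a.succ, by simp⟩
          · exact Or.inr ⟨b, rfl⟩
        · rintro (⟨a, rfl⟩ | ⟨b, rfl⟩)
          · exact Fin.cases (Or.inl (by simp)) (fun a => Or.inr (Or.inl ⟨a, by simp⟩)) a
          · exact Or.inr (Or.inr ⟨b, rfl⟩)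
      · -- `erw`: the decidability instances behind the two `insert`s are only defeq
        erw [grassmannBasis_insert_of_forall_lt R hmin]
        rw [hu, ← mul_assoc, List.ofFn_succ (f := fun a => psiBar R (Fin.cons x i a)),
          List.prod_cons]
        simp only [Fin.cons_zero, Fin.cons_succ]
        rfl
    · -- the new smallest letter is `ψ_y`: then `u` has no `ψ̄`-letter, `k = 0`
      have hk : k = 0 := by
        rcases Nat.eq_zero_or_pos k with hk | hk
        · exact hk
        · exact absurd (hmin _ ((hmem _).2 (Or.inl ⟨⟨0, hk⟩, rfl⟩))) Sum.Lex.not_inr_lt_inl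
      subst hk
      refine ⟨0, l + 1, i, Fin.cons y j, hi, Fin.cons_injective_iff.2 ⟨?_, hj⟩, fun w => ?_, ?_⟩
      · rintro ⟨b, hb⟩
        exact hm ((hmem _).2 (Or.inr ⟨b, by rw [hb]⟩))
      · rw [Finset.mem_insert, hmem]
        constructor
        · rintro (rfl | ⟨a, rfl⟩ | ⟨b, rfl⟩)
          · exact Or.inr ⟨0, by simp⟩
          · exact a.elim0
          · exact Or.inr ⟨b.succ, by simp⟩
        · rintro (⟨a, rfl⟩ | ⟨b, rfl⟩)
          · exact a.elim0
          · exact Fin.cases (Or.inl (by simp)) (fun b => Or.inr (Or.inr ⟨b, by simp⟩)) b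
      · erw [grassmannBasis_insert_of_forall_lt R hmin]
        rw [hu, List.ofFn_zero, List.prod_nil, one_mul, one_mul,
          List.ofFn_succ (f := fun b => psi R (Fin.cons y j b)), List.prod_cons]
        simp only [Fin.cons_zero, Fin.cons_succ]
        rfl

omit [Fintype ι] in
/-- Sums over a set of letters split into its `ψ̄`-block and its `ψ`-block. [folklore] -/
theorem sum_eq_of_mem_iff_blocks {k l : ℕ} {i : Fin k → ι} {j : Fin l → ι}
    (hi : Function.Injective i) (hj : Function.Injective j) {s : Finset (ι ⊕ₗ ι)}
    (hs : ∀ w, w ∈ s ↔ (∃ a, w = toLex (Sum.inl (i a))) ∨ ∃ b, w = toLex (Sum.inr (j b)))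
    {M : Type*} [AddCommMonoid M] (f : ι ⊕ₗ ι → M) :
    ∑ w ∈ s, f w = ∑ a, f (toLex (Sum.inl (i a))) + ∑ b, f (toLex (Sum.inr (j b))) := by
  classical
  have hs' : s = (Finset.univ.image fun a => toLex (Sum.inl (i a))) ∪
      Finset.univ.image fun b => toLex (Sum.inr (j b)) := by
    ext w
    simp only [hs, Finset.mem_union, Finset.mem_image, Finset.mem_univ, true_and, eq_comm]
  have hdisj : Disjoint (Finset.univ.image fun a => toLex (Sum.inl (i a)))
      (Finset.univ.image fun b => toLex (Sum.inr (j b))) := by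
    rw [Finset.disjoint_left]
    intro w h1 h2
    rw [Finset.mem_image] at h1 h2
    obtain ⟨a, -, rfl⟩ := h1
    obtain ⟨b, -, hb⟩ := h2
    exact Sum.inr_ne_inl (toLex.injective hb)
  rw [hs', Finset.sum_union hdisj,
    Finset.sum_image fun a₁ _ a₂ _ h => hi (Sum.inl_injective (toLex.injective h)),
    Finset.sum_image fun b₁ _ b₂ _ h => hj (Sum.inr_injective (toLex.injective h))]

end SumLex

/-! ### Coefficients of the monomial expansion through the Berezin pairing -/

namespace GrassmannAlgebra

variable (R : Type*) [CommRing R] {κ : Type*} [LinearOrder κ] [Fintype κ]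

/-- `∫ θ_t θ_{sᶜ} = [t = s] ε_s`, `ε_s = berezinSign sᶜ univ`. [folklore] -/
theorem berezin_grassmannBasis_mul_grassmannBasis_compl (t s : Finset κ) :
    berezin R κ (grassmannBasis R κ t * grassmannBasis R κ sᶜ) =
      if t = s then (((berezinSign sᶜ Finset.univ : ℤˣ) : ℤ) : R) else 0 := by
  by_cases hd : Disjoint t sᶜ
  · rw [grassmannBasis_mul_grassmannBasis_of_disjoint R hd, map_smul, smul_eq_mul]
    by_cases hts : t = s
    · subst hts
      rw [if_pos rfl, Finset.union_compl, berezin_grassmannBasis_univ, mul_one]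
    · have hne : t ∪ sᶜ ≠ Finset.univ := by
        intro h
        refine hts (Finset.Subset.antisymm (fun x hx => ?_) fun x hx => ?_)
        · by_contra hxs
          exact Finset.disjoint_left.1 hd hx (Finset.mem_compl.2 hxs)
        · have hx' := Finset.mem_univ x
          rw [← h, Finset.mem_union, Finset.mem_compl] at hx'
          exact hx'.resolve_right (not_not.2 hx)
      rw [if_neg hts, berezin_grassmannBasis_of_ne R hne, mul_zero]
  · have hts : t ≠ s := by
      rintro rfl
      exact hd disjoint_compl_right
    rw [grassmannBasis_mul_grassmannBasis_of_not_disjoint R hd, map_zero, if_neg hts]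

/-- **Coefficient extraction by the Berezin pairing**: the coordinate `x_s` of `x` on the monomial
`θ_s` is, up to the sign `ε_s = berezinSign sᶜ univ = ±1`, the Berezin integral of `x θ_{sᶜ}`:
`∫ x θ_{sᶜ} = ε_s x_s` (Montvay–Münster (4.20)–(4.21): the integral over all variables is the top
coefficient; Berezin 1966, (3.4)–(3.5)). [cite: MontvayMunster1994, §4.1.3 (4.21)] -/
theorem berezin_mul_grassmannBasis_compl (x : GrassmannAlgebra R κ) (s : Finset κ) :
    berezin R κ (x * grassmannBasis R κ sᶜ) =
      (((berezinSign sᶜ Finset.univ : ℤˣ) : ℤ) : R) * (grassmannBasis R κ).repr x s := by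
  conv_lhs => rw [← (grassmannBasis R κ).sum_repr x]
  rw [Finset.sum_mul, map_sum]
  simp only [smul_mul_assoc, map_smul, smul_eq_mul,
    berezin_grassmannBasis_mul_grassmannBasis_compl, mul_ite, mul_zero, Finset.sum_ite_eq',
    Finset.mem_univ, if_true]
  rw [mul_comm]

/-- Hence over a normed field `‖x_s‖ = ‖∫ x θ_{sᶜ}‖`. [folklore] -/
theorem norm_repr_grassmannBasis {K : Type*} [NormedField K] {J : Type*} [LinearOrder J] [Fintype J]
    (x : GrassmannAlgebra K J) (s : Finset J) :
    ‖(grassmannBasis K J).repr x s‖ = ‖berezin K J (x * grassmannBasis K J sᶜ)‖ := by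
  rw [berezin_mul_grassmannBasis_compl, norm_mul]
  rcases Int.units_eq_one_or (berezinSign sᶜ (Finset.univ : Finset J)) with h | h <;> simp [h]

/-- If a linear map acts diagonally on the monomials, `φ θ_t = μ_t θ_t`, and `x` is an eigenvector,
`φ x = c x`, then `(μ_s - c) x_s = 0` for every coordinate `x_s` (compare coefficients).
[folklore] -/
theorem sub_mul_repr_eq_zero_of_eigen (φ : GrassmannAlgebra R κ →ₗ[R] GrassmannAlgebra R κ)
    (μ : Finset κ → R) (hφ : ∀ t, φ (grassmannBasis R κ t) = μ t • grassmannBasis R κ t)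
    {x : GrassmannAlgebra R κ} {c : R} (hx : φ x = c • x) (s : Finset κ) :
    (μ s - c) * (grassmannBasis R κ).repr x s = 0 := by
  have h1 : (grassmannBasis R κ).repr (φ x) s = μ s * (grassmannBasis R κ).repr x s := by
    conv_lhs => rw [← (grassmannBasis R κ).sum_repr x]
    simp only [map_sum, map_smul, hφ, smul_smul, Module.Basis.repr_self, Finsupp.coe_finsetSum,
      Finsupp.coe_smul, Finset.sum_apply, Pi.smul_apply, Finsupp.single_apply, smul_eq_mul,
      mul_ite, mul_one, mul_zero, Finset.sum_ite_eq', Finset.mem_univ, if_true]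
    rw [mul_comm]
  have h2 : (grassmannBasis R κ).repr (φ x) s = c * (grassmannBasis R κ).repr x s := by
    rw [hx, map_smul, Finsupp.smul_apply, smul_eq_mul]
  rw [sub_mul, ← h1, h2, sub_self]

/-- **Bilinear expansion of a Berezin integral of a product over two monomial bases**:
`∫ Φ₁(x) Φ₂(y) z = Σ_{s,t} x_s y_t ∫ Φ₁(θ_s) Φ₂(θ_t) z` for algebra maps `Φ₁`, `Φ₂` into a common
Grassmann algebra. [folklore] -/
theorem berezin_map_mul_map_mul {κ₁ κ₂ J : Type*} [LinearOrder κ₁] [Fintype κ₁] [LinearOrder κ₂]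
    [Fintype κ₂] [LinearOrder J] [Fintype J]
    (Φ₁ : GrassmannAlgebra R κ₁ →ₐ[R] GrassmannAlgebra R J)
    (Φ₂ : GrassmannAlgebra R κ₂ →ₐ[R] GrassmannAlgebra R J)
    (x : GrassmannAlgebra R κ₁) (y : GrassmannAlgebra R κ₂) (z : GrassmannAlgebra R J) :
    berezin R J (Φ₁ x * Φ₂ y * z) =
      ∑ s, ∑ t, (grassmannBasis R κ₁).repr x s * (grassmannBasis R κ₂).repr y t *
        berezin R J (Φ₁ (grassmannBasis R κ₁ s) * Φ₂ (grassmannBasis R κ₂ t) * z) := by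
  conv_lhs => rw [← (grassmannBasis R κ₁).sum_repr x, ← (grassmannBasis R κ₂).sum_repr y]
  simp only [map_sum, map_smul, Finset.sum_mul, Finset.mul_sum, smul_mul_assoc, mul_smul_comm,
    smul_eq_mul, mul_assoc]
  rw [Finset.sum_comm]
  exact Finset.sum_congr rfl fun s _ => Finset.sum_congr rfl fun t _ => by ring

end GrassmannAlgebra

end QLatticeAQFT

end Literature.MathematicalPhysics.QuantumLattice
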